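import Summits.ResolutionOfSingularities.ResolutionOfSingularities.Theorems.FrobeniusLadderFRationalResolutionFRationalCM
import HarnessLib

/-!
# Uniform colon capturing for powers of a system of parameters of `S/Q`

Route `FrobeniusLadder`, crux stmt-ResolutionOfSingularities-15317 `FRationalResolution`, line
`Sketch`, theme C (Hochster–Huneke 1994, Prop. 6.27 (a) for `R = S/Q` without a Cohen–Macaulay
hypothesis: one tightly closed parameter ideal ⇒ all). Let `S` be a regular local ring of prime
characteristic `p`, `Q` a prime ideal and `R = S/Q`, `d = dim R`. The non-zero-divisor facts of the
Cohen–Macaulay case are replaced by **colon capturing with a uniform multiplier**: there are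
`c ∈ R ∖ {0}` and `N : ℕ`, depending only on `S, Q`, such that for every system of parameters `s` of
`R` (`d` elements generating an ideal with maximal radical), every index `i`, all exponents
`q = p^e`, `m ≥ 1` and every `v ∈ R`:

`v · s_i^m ∈ (s_j^q : j < i) ⇒ c · v^(p^N) ∈ (s_j^(q p^N) : j < i)`.

Proof (`stub_colonCapturing_sop_pow`; Hochster–Huneke 1990 §7, Huneke, *Tight closure and its
applications*, Thm. 3.1). Once and for all choose `y ⊆ Q` with `dim S/(y) = d`
(`colonCapturing_exists_prefix`); `Q` is minimal over `(y)`, so some `c ∉ Q` and `N` satisfy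
`c · Q^N ⊆ (y)` (`colonCapturing_exists_mul_pow_mem`). Given `s, i, e, m, v`, the modified family
`s'_j = s_j^(k_j)` (`k_j = p^e` for `j < i`, `k_i = m`, `k_j = 1` for `j > i`) is again a system of
parameters (same radical), the hypothesis reads `v · s'_i ∈ (s'_j : j < i)`, and lifts `x` of `s'`
with `(y, x)` a system of parameters of `S` exist (`colonCapturing_exists_lifts`). Colon capturing
upstairs with the explicit threshold `e ≥ N` (`colonCapturing_sop_pow_upstairs`, the proof of
`colonCapturing_quotient`) at the exponent `p^N` gives `c · u^(p^N) ∈ (x_j^(p^N) : j < i) + Q` for a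
lift `u` of `v`; pushing down to `S/Q`, `(s'_j)^(p^N) = s_j^(p^(e+N))` for `j < i`.
-/

-- single-problem summit: the doubled namespace component `ResolutionOfSingularities` is forced
set_option linter.dupNamespace false

noncomputable section

open IsLocalRing RingTheory.Sequence Literature.RingTheory.TightClosure
  Literature.RingTheory.RegularLocalRing Literature.AlgebraicGeometry.Resolution

namespace Summit.ResolutionOfSingularities.ResolutionOfSingularities.Theorems.FRationalResolution

/-- Replacing each member of a family by a positive power of itself does not change the radical of
the ideal the family generates. -/
theorem colonCapturing_sop_pow_radical_span_pow {R : Type} [CommRing R] {ι : Type} (s : ι → R)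
    (k : ι → ℕ) (hk : ∀ j, 0 < k j) :
    (Ideal.span (Set.range fun j => s j ^ k j)).radical = (Ideal.span (Set.range s)).radical := by
  refine le_antisymm (Ideal.radical_le_radical_iff.mpr (Ideal.span_le.mpr ?_))
    (Ideal.radical_le_radical_iff.mpr (Ideal.span_le.mpr ?_))
  · rintro _ ⟨j, rfl⟩
    exact Ideal.pow_mem_of_mem _ (Ideal.le_radical (Ideal.subset_span (Set.mem_range_self j)))
      _ (hk j)
  · rintro _ ⟨j, rfl⟩
    exact ⟨k j, Ideal.subset_span (Set.mem_range_self (f := fun j => s j ^ k j) j)⟩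

/-- **Colon capturing upstairs with the explicit threshold** (the proof of
`colonCapturing_quotient`, Hochster–Huneke 1990, §7; Huneke, *Tight Closure and its Applications*,
Thm. 3.1): `S` regular local of characteristic `p` and dimension `h + d`, `Q` prime, `(y, x)` a
system of parameters of `S` with `y ⊆ Q`, `c · Qᴺ ⊆ (y)`. If `u · x_i ∈ (x_j : j < i) + Q` then
`c · u^q ∈ (x_j^q : j < i) + Q` for every `q = p^e` with `e ≥ N`. -/
theorem colonCapturing_sop_pow_upstairs (p : ℕ) [Fact p.Prime] (S : Type) [CommRing S]
    [IsRegularLocalRing S] [CharP S p] (Q : Ideal S) [Q.IsPrime] {d h : ℕ}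
    (hdim : ringKrullDim S = ↑(h + d)) (y : Fin h → S) (x : Fin d → S) (hy : ∀ j, y j ∈ Q)
    (hsop : (Ideal.span (Set.range y ∪ Set.range x)).radical.IsMaximal) (c : S) (N : ℕ)
    (hcN : ∀ z ∈ Q ^ N, c * z ∈ Ideal.span (Set.range y)) (i : Fin d) (u : S)
    (hu : u * x i ∈ Ideal.span (x '' Set.Iio i) ⊔ Q) (e : ℕ) (he : N ≤ e) :
    c * u ^ p ^ e ∈ Ideal.span ((fun j : Fin d => x j ^ p ^ e) '' Set.Iio i) ⊔ Q := by
  -- adapted from `colonCapturing_quotient` (…ColonCapturingUpstairs.lean), threshold exposed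
  have hp : p.Prime := Fact.out
  have hNq : N ≤ p ^ e := he.trans (Nat.lt_pow_self hp.one_lt).le
  have hrad : (Ideal.span (Set.range y ∪ Set.range x)).radical = maximalIdeal S :=
    IsLocalRing.eq_maximalIdeal hsop
  have hym : ∀ j, y j ∈ maximalIdeal S := fun j =>
    IsLocalRing.le_maximalIdeal (Ideal.IsPrime.ne_top ‹_›) (hy j)
  have hxm : ∀ j, x j ∈ maximalIdeal S := fun j =>
    hrad ▸ Ideal.le_radical (Ideal.subset_span (Or.inr ⟨j, rfl⟩))
  -- Frobenius: `c u^q x_i^q = c a^q + c w^q ∈ (x_j^q : j < i) + (y)`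
  obtain ⟨a, ha, w, hw, haw⟩ := Submodule.mem_sup.mp hu
  have haq : a ^ p ^ e ∈ Ideal.span ((fun j : Fin d => x j ^ p ^ e) '' Set.Iio i) := by
    have h1 := pow_mem_frobeniusPower (q := p ^ e) ha
    rwa [frobeniusPower_span p e, Set.image_image] at h1
  have hwq : c * w ^ p ^ e ∈ Ideal.span (Set.range y) :=
    hcN _ (Ideal.pow_le_pow_right hNq (Ideal.pow_mem_pow hw _))
  have hkey : c * u ^ p ^ e * x i ^ p ^ e ∈
      Ideal.span ((fun j : Fin d => x j ^ p ^ e) '' Set.Iio i) ⊔ Ideal.span (Set.range y) := by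
    rw [mul_assoc, ← mul_pow, ← haw, add_pow_char_pow, mul_add]
    exact Submodule.add_mem_sup (Ideal.mul_mem_left _ _ haq) hwq
  -- regularity upstairs: `x_i^q` is a non-zero-divisor modulo `(x_j^q : j < i) + (y)`
  have hmem := colonCapturing_quotient_mem_of_mul_mem S hdim y (fun j : Fin d => x j ^ p ^ e) hym
    (fun j => Ideal.pow_mem_of_mem _ (hxm j) _ (pow_pos hp.pos e)) ?_ i (c * u ^ p ^ e) hkey
  · exact (sup_le le_sup_left ((Ideal.span_le.mpr (by rintro _ ⟨j, rfl⟩; exact hy j)).trans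
      le_sup_right) : Ideal.span ((fun j : Fin d => x j ^ p ^ e) '' Set.Iio i) ⊔
        Ideal.span (Set.range y) ≤ _) hmem
  · -- `𝔪 = rad (y, x) ≤ rad (y, x^q)`
    rw [← hrad]
    refine Ideal.radical_le_radical_iff.mpr (Ideal.span_le.mpr ?_)
    rintro r (⟨j, rfl⟩ | ⟨j, rfl⟩)
    · exact Ideal.le_radical (Ideal.subset_span (Or.inl ⟨j, rfl⟩))
    · exact ⟨p ^ e, Ideal.subset_span (Or.inr ⟨j, rfl⟩)⟩

/-- **Uniform colon capturing for powers of a system of parameters** of `R = S/Q`, `S` regular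
local of prime characteristic `p`, `Q` prime, `d = dim R` (Hochster–Huneke 1990, §7; 1994,
Thm. 4.2 (c) / Prop. 6.27 (a)): there are `c ∈ R ∖ {0}` and `N : ℕ` such that for every system of
parameters `s` of `R`, every `i`, `q = p^e`, `m ≥ 1` and `v ∈ R`,
`v · s_i^m ∈ (s_j^q : j < i) ⇒ c · v^(p^N) ∈ (s_j^(p^(e+N)) : j < i)`. -/
theorem stub_colonCapturing_sop_pow (p : ℕ) [Fact p.Prime] (S : Type) [CommRing S] [IsRegularLocalRing S]
    [CharP S p] (Q : Ideal S) [Q.IsPrime] {d : ℕ} (hd : ringKrullDim (S ⧸ Q) = d) :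
    ∃ c : S ⧸ Q, c ≠ 0 ∧ ∃ N : ℕ, ∀ s : Fin d → S ⧸ Q, (Ideal.span (Set.range s)).radical.IsMaximal →
      ∀ (i : Fin d) (e m : ℕ) (v : S ⧸ Q), 0 < m →
        v * s i ^ m ∈ Ideal.span ((fun j : Fin d => s j ^ p ^ e) '' Set.Iio i) →
        c * v ^ p ^ N ∈ Ideal.span ((fun j : Fin d => s j ^ p ^ (e + N)) '' Set.Iio i) := by
  classical
  have hp : p.Prime := Fact.out
  haveI : IsDomain S := isDomain_of_isRegularLocalRing S
  have hQtop : Q ≠ ⊤ := ‹Q.IsPrime›.ne_top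
  haveI : Nontrivial (S ⧸ Q) := Ideal.Quotient.nontrivial_iff.mpr hQtop
  set π := Ideal.Quotient.mk Q with hπ
  -- dimension bookkeeping: `dim S = n`, `d ≤ n`
  obtain ⟨n, hn⟩ := exists_nat_cast_eq_ringKrullDim (R := S)
  have hdn : d ≤ n := by
    have h := ringKrullDim_le_of_surjective π Ideal.Quotient.mk_surjective
    rw [hn, hd] at h
    exact_mod_cast h
  have hdim : ringKrullDim S = ↑((n - d) + d) := by rw [Nat.sub_add_cancel hdn]; exact hn
  -- (a) once and for all: `y ⊆ Q` with `dim S/(y) = d`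
  obtain ⟨y, hyQ, hyd⟩ := colonCapturing_exists_prefix S Q hn hd
  -- (b) `Q` is minimal over `(y)`, whence the multiplier `c ∉ Q` and `N` with `c·Q^N ⊆ (y)`
  have hJQ : Ideal.span (Set.range y) ≤ Q := Ideal.span_le.mpr (by rintro _ ⟨j, rfl⟩; exact hyQ j)
  have hQmin : Q ∈ (Ideal.span (Set.range y)).minimalPrimes := by
    refine ⟨⟨inferInstance, hJQ⟩, fun P ⟨hP, hJP⟩ hPQ => ?_⟩
    have hdimP : ringKrullDim (S ⧸ P) = d := by
      refine le_antisymm ?_ ?_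
      · have h := ringKrullDim_le_of_surjective (Ideal.Quotient.factor hJP)
          (Ideal.Quotient.factor_surjective hJP)
        rwa [hyd] at h
      · have h := ringKrullDim_le_of_surjective (Ideal.Quotient.factor hPQ)
          (Ideal.Quotient.factor_surjective hPQ)
        rwa [hd] at h
    exact (eq_of_le_of_ringKrullDim_quotient_eq' hP hPQ hdimP hd).ge
  obtain ⟨c, hcQ, N, hcN⟩ := colonCapturing_exists_mul_pow_mem S (Ideal.span (Set.range y)) Q hQmin
  have hcne : π c ≠ 0 := fun h => hcQ ((Ideal.Quotient.eq_zero_iff_mem).mp h)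
  refine ⟨π c, hcne, N, fun s hs i e m v hm hv => ?_⟩
  -- (c) the modified system of parameters `s' j = s j ^ k j`
  obtain ⟨k, hkpos, hki, hklt⟩ : ∃ k : Fin d → ℕ, (∀ j, 0 < k j) ∧ k i = m ∧
      ∀ j, j < i → k j = p ^ e := by
    refine ⟨fun j => if j < i then p ^ e else if j = i then m else 1, fun j => ?_, ?_, ?_⟩
    · dsimp only
      split_ifs
      exacts [pow_pos hp.pos e, hm, Nat.one_pos]
    · dsimp only
      rw [if_neg (lt_irrefl i), if_pos rfl]
    · intro j hj
      dsimp only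
      rw [if_pos hj]
  obtain ⟨s', hs'k⟩ : ∃ s' : Fin d → S ⧸ Q, ∀ j, s' j = s j ^ k j := ⟨_, fun j => rfl⟩
  have hs'rad : (Ideal.span (Set.range s')).radical.IsMaximal := by
    rw [show s' = fun j => s j ^ k j from funext hs'k,
      colonCapturing_sop_pow_radical_span_pow s k hkpos]
    exact hs
  -- (d) lifts `x` of `s'` with `(y, x)` a system of parameters of `S`
  set x₀ : Fin d → S := fun j => (Ideal.Quotient.mk_surjective (s' j)).choose with hx₀
  have hx₀s : ∀ j, π (x₀ j) = s' j := fun j => (Ideal.Quotient.mk_surjective (s' j)).choose_spec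
  have hx₀rad : (Ideal.span (Set.range fun j => Ideal.Quotient.mk Q (x₀ j))).radical.IsMaximal := by
    have : (fun j => Ideal.Quotient.mk Q (x₀ j)) = s' := funext hx₀s
    rw [this]
    exact hs'rad
  obtain ⟨x, hxQ, hsop⟩ := colonCapturing_exists_lifts S Q y hyQ hyd hd x₀ hx₀rad
  have hxs : ∀ j, π (x j) = s' j := fun j => by
    rw [← hx₀s j, hπ, Ideal.Quotient.mk_eq_mk_iff_sub_mem]
    exact hxQ j
  -- (e) the hypothesis reads `v · s'_i ∈ (s'_j : j < i)`; lift it upstairs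
  have hv' : v * s' i ∈ Ideal.span (s' '' Set.Iio i) := by
    have h1 : s' '' Set.Iio i = (fun j : Fin d => s j ^ p ^ e) '' Set.Iio i :=
      Set.image_congr fun j hj => by rw [hs'k j, hklt j hj]
    rw [h1, hs'k i, hki]
    exact hv
  obtain ⟨u, rfl⟩ := Ideal.Quotient.mk_surjective v
  have hu : u * x i ∈ Ideal.span (x '' Set.Iio i) ⊔ Q := by
    have h1 : π (u * x i) ∈ (Ideal.span (x '' Set.Iio i)).map π := by
      rw [Ideal.map_span, Set.image_image]
      have : (fun j => π (x j)) '' Set.Iio i = s' '' Set.Iio i := by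
        ext r; simp only [Set.mem_image, hxs]
      rw [this, map_mul, hxs]
      exact hv'
    have h2 := Ideal.mem_comap.mpr h1
    rwa [Ideal.comap_map_of_surjective π Ideal.Quotient.mk_surjective,
      show Ideal.comap π ⊥ = Q from by rw [← RingHom.ker_eq_comap_bot, hπ, Ideal.mk_ker]] at h2
  -- (f) colon capturing upstairs at the exponent `p^N`, pushed down to `S/Q`
  have hup := colonCapturing_sop_pow_upstairs p S Q hdim y x hyQ hsop c N hcN i u hu N le_rfl
  have h1 : π (c * u ^ p ^ N) ∈
      (Ideal.span ((fun j : Fin d => x j ^ p ^ N) '' Set.Iio i) ⊔ Q).map π :=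
    Ideal.mem_map_of_mem _ hup
  have hmapI : (Ideal.span ((fun j : Fin d => x j ^ p ^ N) '' Set.Iio i)).map π =
      Ideal.span ((fun j : Fin d => s j ^ p ^ (e + N)) '' Set.Iio i) := by
    rw [Ideal.map_span, Set.image_image]
    congr 1
    refine Set.image_congr fun j hj => ?_
    rw [map_pow, hxs, hs'k j, hklt j hj, ← pow_mul, ← pow_add]
  rw [Ideal.map_sup, Ideal.map_quotient_self, sup_bot_eq, hmapI] at h1
  simpa only [map_mul, map_pow] using h1

end Summit.ResolutionOfSingularities.ResolutionOfSingularities.Theorems.FRationalResolution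

end
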